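import Literature.NumberTheory.Transcendental.ExpAlgebraicTranscendenceMeasureCore
import Literature.NumberTheory.Transcendental.PiTranscendenceMeasureCore

/-!
# RootDecomp1KNW96Core — lens 6, generation 23 «NW96 CORE» (PROGRAMME G23-a of VERDICT L2098, CHECKLIST L2131; THEOREM lane, FACT-FREE): the GENERAL core of Nesterenko–Waldschmidt 1996 §6 a)–d) — conclusion False from an explicit displayed main inequality with ALL parameters free, over F : IntermediateField ℚ ℂ finite over ℚ, θ ∈ ℂ arbitrary, α β ∈ F non-zero of ANY height, TWO-SIDED perturbation ‖e^θ − α‖ + ‖θ − β‖, the HONEST signed column range |s| ≤ S₁ (the g22 audit's finding) and a SHARP two-variable Liouville step charging (D − 1) — part 1 (RootDecomp1KNW96Core01): §1 sharp Liouville inequality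

(lens-6 g23 HOME kernel NW96Core.lean 19b22368…, 953 l, imports Literature ExpAlgebraicTranscendenceMeasureCore + PiTranscendenceMeasureCore (tree-only); CLAIM L2129, ACK/CHECKLIST G23-a L2131, NODE L2136 / REQUEST L2137, critic VERDICT L2143 (crit g9: CLEARED — THEOREM ×1 (G23-a); lens-6 tally THEOREM ×5 + CELL ×3 + AUDIT ×1; PORT GO in substance Summit-side now `--supports stmt-Schanuel-33364`, the scoped `maxHeartbeats 2000000` flagged for the port record; Literature-side relocation = one ticket with G23-b later); port by census-1 gen 18 as `RootDecomp1KNW96Core01`–`03`: 01 = §1 the sharp local–global / two-variable Liouville inequality (length charged with D − 1) in the Height.AdmissibleAbsValues framework; 02 = §2 general-θ entries (derivatives of Fel'dman's Δ-basis × e^{θtz}, the two-sided perturbation, the scaled integer form); 03 = §3 THE CORE THEOREM `core` (one ≈ 380-line proof, steps a)–d), scoped `maxHeartbeats 2000000` carried as in K).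
PORT EDITS: `set_option linter.dupNamespace false` and the unused `import HarnessLib` dropped; statements and proofs verbatim (0 undocumented decls in K). `--supports stmt-Schanuel-33364`; no census credit carried; rung 0 — nothing here proves Schanuel, and nothing here asserts any constant for NW96 Thm 1.)
-/

/-!
# RootDecomp1KNW96Core — lens 6, generation 23 «NW96 CORE»

HOME kernel of the cell `decomp-schanuel`, lens 6 (theorem lane, PATH T: sorry-free, FACT-FREE kernels;
no ledger writes), PROGRAMME G23-a of the critic's VERDICT (bus STATUS L2098 / checklist L2131), written
against the LIVE route `route-Schanuel-RootDecomp1K` (rev 8).  Port target (census's call):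
`Summits/Schanuel/Schanuel/Theorems/RootDecomp1KNW96Core.lean` or Literature-side next to
`PiTranscendenceMeasureCore.lean`.

## What this file proves (no `sorry`, no named fact as hypothesis, tree imports only)

The registered Literature fact `NesterenkoWaldschmidt1996_thm_1` (NW96 Main Theorem, constant `211`;
`ExpLogSimultaneousApproximationMeasure.lean`) is consumed as a HYPOTHESIS by the route's kernels.  Gen 22
(`RootDecomp1KNW96Gap`) showed that the printed proof does not establish `211` (printed Lemma 6 is
misstated; with the proved signed row range the width of step c) doubles) and typed the repair target
`NW1996MainR c`.  The hypothesis-free proof of `NW1996MainR 400` (PROGRAMME G23-b) needs, first, the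
GENERAL CORE of [NesterenkoWaldschmidt1996, §6 a)–d)] — the tree has it only for `θ = πi`, `α = −1`
(`NWPi.pi_core`, `PiTranscendenceMeasureCore.lean`: `h(α) = 0`, one-sided perturbation `|β − πi|`).
This file supplies it:

* §1 `one_le_absValue_mul_of_forall_absValue_le`, `liouville₂_sharp` — the SHARP two-variable Liouville
  inequality over a subfield `F ⊂ ℂ` finite over `ℚ`, in the `Height.AdmissibleAbsValues` framework via
  `Height.AdmissibleAbsValues.product_formula`: for `v = ∑ a_l β^{e₁(l)} ξ^{e₂(l)} ≠ 0`, `e₁ ≤ D₁`, `e₂ ≤ D₂`,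
  `log|v| ≥ −(D − 1)·log max(1, ∑|a_l|) − D·(D₁ h(β) + D₂ h(ξ))`, `D = [F:ℚ]` — the length is charged
  with `D − 1` (the product formula is divided by the local bounds at every place EXCEPT the given complex
  one), where the tree's `Waldschmidt1978.liouville₂` charges `D`.  At `D = 1` the length term vanishes.
  This exponent is load-bearing for the `c₀ = 400` budget of REPAIR-v2 §4 (lens 6 g22): the analytic side
  already pays the length-like quantity `log L + ψSH + S log S + H + T + T log(1+S₁/H) + S log T₁` ONCE
  (inside `L·M` and `L log L`), Liouville pays it `D − 1` more times, total coefficient `D` as in the printed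
  budget (6.8)–(6.11); with the `D`-form the coefficient would be `D + 1`, i.e. at `D = 1` an extra
  `≈ ψah + a + c + h/6 + 0.24 ≈ 90·DUVW·log E` against a margin of `6.74` — the repaired scheme would not close.
* §2 general-`θ` entry lemmas: `norm_iteratedDeriv_f_le'` (two constants: `K ≥ max(1,|θ|T₁)` for the powers,
  `K' = |θ|T₁` in the exponential — so the main theorem's `2E|θ|`, not `2E|θ|₊`, is reachable),
  `iteratedDeriv_f_int'`, the TWO-SIDED perturbation `norm_alg_sub_analytic_le'`
  (`|β^kα^ℓ − θ^k e^{θℓ}| ≤ R^S B^{N+1}(S|β−θ| + N|α−e^θ|)`, `N = T₁S₁`, through the sharp Laurent-monomial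
  bound `norm_zpow_sub_zpow_le_sharp`: `|a^j − b^j| ≤ N B^{N+1}|a − b|`, `|j| ≤ N`, where the tree's
  `Waldschmidt1978.norm_zpow_sub_zpow_le'` has `B^{3N}`), and the scaled integer form `scaled_entry_eq'`
  (`ν(H)^σ·((∂+tβ)^σΔ_τ)(s) = ∑_k p_k β^{σ−k}` with the SAME integers `NWPi.pZ` as the `π`-file).
* §3 `core` — ONE theorem, conclusion `False`, from: `α, β ≠ 0` in `F`, `[F:ℚ] ≤ Dr`, `[F:ℚ]h(β) ≤ H_β`,
  `[F:ℚ]h(α) ≤ H_α` (ANY height), natural parameters `H, T₁ ≥ 1`, `T, S, S₁` with the zero-estimate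
  condition (2.1) (`2T₁ ≤ S+1`, `(2T₁+1)T < (S+1−2T₁)(2S₁+1)`), `L = (T+1)(2T₁+1)`, the HONEST width
  `m = S₁(T+1)T₁(T₁+1)` (`deg_α + deg_{α⁻¹} ≤ 2m`), reals `E ≥ 1`, `R ≥ max(1,|β|,|θ|)`,
  `B ≥ max(1, |α|^{±1}, |e^θ|^{±1})`, `lν ≥ log ν(H)`, one real `M` with the two displayed domination
  hypotheses `hMf` (analytic data) and `hMp` (two-sided perturbation `S|β − θ| + T₁S₁|α − e^θ|`, scaled by
  `E^L`), and the displayed MAIN INEQUALITY `hmain` (all parameters free; no numeral budget inside).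
  `θ ∈ ℂ` is arbitrary (no hypothesis `θ ≠ 0` is needed at this level).

## Reuse (tree lemma ↦ step; nothing re-proved under a new name)

a) matrix + zero estimate + Lemma 6 (signed range) + column independence: `NWPi.algMatrix_mulVec_eq_zero_pi`
(general `α ≠ 0` already), `NW1996.exists_submatrix_det_ne_zero`, `NW1996.abs_coord_le`;
b) `NWPi.differentiable_f`, `NWPi.iteratedDeriv_f`, `FeldmanDelta.sum_choose_mul_factorial_mul_norm_hasse_le`,
`FeldmanDelta.sum_choose_mul_factorial_mul_hasse_le`, `FeldmanDelta.abs_hasseZ_le`, `NWPi.norm_pow_sub_pow_le_of_le`,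
`NWPi.pow_self_le_pow_self`, Lemma 3 = `NW1996.norm_det_interpolation_deriv_le`;
c) `NWPi.eval_twist_pow_delta`, `NWPi.pZ`, `NWPi.cast_pZ`, `NWPi.pZ_of_lt`, `NWPi.sum_abs_pZ_le` (Lemma 4 +
`ν(H)`), the shift bookkeeping `NW1996.shift_nonneg/shift_le/sum_natAbs_sub_eq`, `Matrix.det_mul_row/column`,
`Waldschmidt1978.det_expand`, `Waldschmidt1978.sum_abs_detCoeff_le`, and §1's `liouville₂_sharp`
(local estimates `Height.absValue_sum_intCast_mul_pow_mul_pow_le[_of_isNonarchimedean]`,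
`Height.weilHeight₁_single_eq`, `Height.AdmissibleAbsValues.totalWeight_eq_finrank`);
d) real logarithms (`Real.log_*`, `linarith`).

## Not claimed

No parameters are chosen here and no instance of `NW1996MainR c` is derived (that is G23-b,
`NW96Params400`); no item of the route closes; the registered fact is neither used nor discharged.
-/

noncomputable section

open Finset

namespace Summit.Schanuel.Schanuel.Theorems.RootDecomp1KNW96Core

open Literature.NumberTheory.Transcendental

/-! ## §1  Sharp Liouville inequality: the length is charged with `D − 1`, not `D` -/

section SharpLocalGlobal

open Height AdmissibleAbsValues

variable {K : Type*} [Field K] [AdmissibleAbsValues K]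

/-- **Sharp local-to-global lower bound.**  Let `C ≥ 1`, `y ≠ 0`, and `v₀` one of the archimedean
absolute values of the admissible family.  If `v y ≤ C ∏ᵢ max(v xᵢ, 1)^{eᵢ}` at every archimedean `v`
and `v y ≤ ∏ᵢ max(v xᵢ, 1)^{eᵢ}` at every non-archimedean `v`, then
`1 ≤ v₀(y) · C^{totalWeight K − 1} · ∏ᵢ H(xᵢ)^{eᵢ}`:
the product formula `∏_v v(y) = 1` is divided by the local bounds at every `v ≠ v₀`, so the
constant `C` is paid `totalWeight K − 1` times only (Waldschmidt GL326 §3.5; Fel'dman 1982 Lemma 9.2;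
[NesterenkoWaldschmidt1996, §5 Lemma 5] — the exponent `D − 1` of the length). [folklore] -/
theorem one_le_absValue_mul_of_forall_absValue_le {ι : Type*} (s : Finset ι) {y : K} (hy : y ≠ 0)
    {x : ι → K} {e : ι → ℕ} {C : ℝ} (hC : 1 ≤ C) {v₀ : AbsoluteValue K ℝ} (hv₀ : v₀ ∈ archAbsVal)
    (harch : ∀ v ∈ archAbsVal, v y ≤ C * ∏ i ∈ s, max (v (x i)) 1 ^ e i)
    (hna : ∀ v ∈ nonarchAbsVal, v y ≤ ∏ i ∈ s, max (v (x i)) 1 ^ e i) :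
    1 ≤ v₀ y * (C ^ (totalWeight K - 1) * ∏ i ∈ s, mulHeight₁ (x i) ^ e i) := by
  classical
  have hC0 : 0 ≤ C := zero_le_one.trans hC
  -- split off `v₀` from the archimedean absolute values
  have hsplit : (archAbsVal.map (· y)).prod = v₀ y * ((archAbsVal.erase v₀).map (· y)).prod := by
    conv_lhs => rw [← Multiset.cons_erase hv₀]
    rw [Multiset.map_cons, Multiset.prod_cons]
  -- the remaining archimedean factors
  have hA1 : ((archAbsVal.erase v₀).map (· y)).prod ≤
      ((archAbsVal.erase v₀).map fun v ↦ C * ∏ i ∈ s, max (v (x i)) 1 ^ e i).prod :=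
    Multiset.prod_map_le_prod_map₀ _ _ (fun v _ ↦ v.nonneg y)
      fun v hv ↦ harch v (Multiset.mem_of_mem_erase hv)
  have hA2 : ((archAbsVal.erase v₀).map fun v ↦ C * ∏ i ∈ s, max (v (x i)) 1 ^ e i).prod =
      C ^ (totalWeight K - 1) *
        ∏ i ∈ s, ((archAbsVal.erase v₀).map fun v ↦ max (v (x i)) 1).prod ^ e i := by
    rw [Multiset.prod_map_mul, Multiset.map_const', Multiset.prod_replicate, Multiset.prod_map_prod,
      Multiset.card_erase_of_mem hv₀, Nat.pred_eq_sub_one, totalWeight]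
    congr 1
    exact prod_congr rfl fun i _ ↦ Multiset.prod_map_pow
  have hEpos : ∀ i, 0 ≤ ((archAbsVal.erase v₀).map fun v ↦ max (v (x i)) 1).prod := fun i ↦
    Multiset.prod_nonneg fun a ha ↦ by
      obtain ⟨v, _, rfl⟩ := Multiset.mem_map.mp ha
      positivity
  have hA3 : ∀ i, ((archAbsVal.erase v₀).map fun v ↦ max (v (x i)) 1).prod ≤
      (archAbsVal.map fun v ↦ max (v (x i)) 1).prod := by
    intro i
    conv_rhs => rw [← Multiset.cons_erase hv₀]
    rw [Multiset.map_cons, Multiset.prod_cons]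
    exact le_mul_of_one_le_left (hEpos i) (le_max_right _ _)
  have hA : ((archAbsVal.erase v₀).map (· y)).prod ≤
      C ^ (totalWeight K - 1) * ∏ i ∈ s, (archAbsVal.map fun v ↦ max (v (x i)) 1).prod ^ e i := by
    refine hA1.trans ?_
    rw [hA2]
    refine mul_le_mul_of_nonneg_left ?_ (pow_nonneg hC0 _)
    exact prod_le_prod (fun i _ ↦ pow_nonneg (hEpos i) _)
      fun i _ ↦ pow_le_pow_left₀ (hEpos i) (hA3 i) _
  -- non-archimedean part
  have hN1 : ∏ᶠ v : nonarchAbsVal, v.val y ≤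
      ∏ᶠ v : nonarchAbsVal, ∏ i ∈ s, max (v.val (x i)) 1 ^ e i :=
    finprod_le_finprod (hasFiniteMulSupport hy) (fun v ↦ v.val.nonneg y)
      (hasFiniteMulSupport_prod_max_one_pow s x e) fun v ↦ hna v.val v.prop
  have hN2 : ∏ᶠ v : nonarchAbsVal, ∏ i ∈ s, max (v.val (x i)) 1 ^ e i =
      ∏ i ∈ s, (∏ᶠ v : nonarchAbsVal, max (v.val (x i)) 1) ^ e i := by
    rw [finprod_prod_comm s (fun (v : nonarchAbsVal) i ↦ max (v.val (x i)) 1 ^ e i)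
      fun i _ ↦ (hasFiniteMulSupport_max_one (x i)).pow (e i)]
    exact prod_congr rfl fun i _ ↦ (finprod_pow (hasFiniteMulSupport_max_one (x i)) (e i)).symm
  have hN := hN1.trans_eq hN2
  -- combine with the product formula
  have hRpos : 0 ≤ ((archAbsVal.erase v₀).map (· y)).prod :=
    Multiset.prod_nonneg fun a ha ↦ by
      obtain ⟨v, _, rfl⟩ := Multiset.mem_map.mp ha
      exact v.nonneg y
  have hNpos : 0 ≤ ∏ᶠ v : nonarchAbsVal, v.val y := finprod_nonneg fun v ↦ v.val.nonneg y
  have hXpos : 0 ≤ C ^ (totalWeight K - 1) *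
      ∏ i ∈ s, (archAbsVal.map fun v ↦ max (v (x i)) 1).prod ^ e i := hRpos.trans hA
  calc (1 : ℝ) = v₀ y * ((archAbsVal.erase v₀).map (· y)).prod * ∏ᶠ v : nonarchAbsVal, v.val y := by
        rw [← hsplit, product_formula hy]
    _ ≤ v₀ y * (C ^ (totalWeight K - 1) * ∏ i ∈ s, (archAbsVal.map fun v ↦ max (v (x i)) 1).prod ^ e i) *
          ∏ i ∈ s, (∏ᶠ v : nonarchAbsVal, max (v.val (x i)) 1) ^ e i :=
        mul_le_mul (mul_le_mul_of_nonneg_left hA (v₀.nonneg y)) hN hNpos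
          (mul_nonneg (v₀.nonneg y) hXpos)
    _ = v₀ y * (C ^ (totalWeight K - 1) * ∏ i ∈ s, mulHeight₁ (x i) ^ e i) := by
        rw [mul_assoc, mul_assoc, ← prod_mul_distrib]
        congr 2
        exact prod_congr rfl fun i _ ↦ by rw [← mul_pow, Height.mulHeight₁_eq]

end SharpLocalGlobal

/-! ### The sharp two-variable Liouville inequality in a number field `F ⊂ ℂ` -/

section SharpLiouville

open Height NumberField

/-- **Liouville's inequality for an integer polynomial in two algebraic numbers, sharp form**
([NesterenkoWaldschmidt1996, §5 Lemma 5] with `n = 2` and `D' = D`; Fel'dman 1982 Lemma 9.2).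
Let `F ⊂ ℂ` be a subfield finite over `ℚ` of degree `D`, `β, ξ ∈ F`, and
`v = ∑_{l ∈ s} a_l β^{e₁ l} ξ^{e₂ l}` with `a_l ∈ ℤ`, `e₁ l ≤ D₁`, `e₂ l ≤ D₂`.  If `v ≠ 0` then
`log |v| ≥ −(D − 1) · log max(1, ∑|a_l|) − D · (D₁ h(β) + D₂ h(ξ))`, `h = weilHeight₁ F` the
absolute logarithmic Weil height.  (The tree's `Waldschmidt1978.liouville₂` is the weaker form with
`D` in place of `D − 1`; the sharp exponent comes from `one_le_absValue_mul_of_forall_absValue_le`.)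
[cite: NesterenkoWaldschmidt1996, §5 Lemma 5] -/
theorem liouville₂_sharp (F : IntermediateField ℚ ℂ) [FiniteDimensional ℚ F] {β ξ : ℂ} (hβ : β ∈ F)
    (hξ : ξ ∈ F) {ι : Type*} (s : Finset ι) (a : ι → ℤ) (e₁ e₂ : ι → ℕ) {D₁ D₂ : ℕ}
    (hD : ∀ l ∈ s, e₁ l ≤ D₁ ∧ e₂ l ≤ D₂)
    (hv : ∑ l ∈ s, (a l : ℂ) * β ^ e₁ l * ξ ^ e₂ l ≠ 0) :
    -(((Module.finrank ℚ F : ℝ) - 1) * Real.log (max 1 (∑ l ∈ s, |(a l : ℝ)|)) +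
        (Module.finrank ℚ F : ℝ) *
          (D₁ * weilHeight₁ F (fun _ : Unit => β) + D₂ * weilHeight₁ F (fun _ : Unit => ξ))) ≤
      Real.log ‖∑ l ∈ s, (a l : ℂ) * β ^ e₁ l * ξ ^ e₂ l‖ := by
  haveI : NumberField F := numberField_of_intermediateField F
  set β' : F := ⟨β, hβ⟩ with hβ'
  set ξ' : F := ⟨ξ, hξ⟩ with hξ'
  set v' : F := ∑ l ∈ s, (a l : F) * β' ^ e₁ l * ξ' ^ e₂ l with hv'
  have hcoe : (algebraMap F ℂ) v' = ∑ l ∈ s, (a l : ℂ) * β ^ e₁ l * ξ ^ e₂ l := by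
    rw [hv', map_sum]
    refine Finset.sum_congr rfl fun l _ => ?_
    rw [map_mul, map_mul, map_pow, map_pow, map_intCast]
    rfl
  have hv'0 : v' ≠ 0 := by
    intro h
    apply hv
    rw [← hcoe, h, map_zero]
  -- the archimedean absolute value of the inclusion `F ⊂ ℂ`
  set v₀ : AbsoluteValue F ℝ := NumberField.place (algebraMap F ℂ : F →+* ℂ) with hv₀def
  have hv₀ : v₀ ∈ (AdmissibleAbsValues.archAbsVal : Multiset (AbsoluteValue F ℝ)) :=
    mem_multisetInfinitePlace.mpr ⟨_, rfl⟩
  have hv₀v : v₀ v' = ‖∑ l ∈ s, (a l : ℂ) * β ^ e₁ l * ξ ^ e₂ l‖ := by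
    rw [hv₀def, NumberField.place_apply, hcoe]
  -- local estimates
  set C : ℝ := max 1 (∑ l ∈ s, |(a l : ℝ)|) with hC
  have hC1 : 1 ≤ C := le_max_left _ _
  have hloc : ∀ v : AbsoluteValue F ℝ,
      ∏ i : Fin 2, max (v (![β', ξ'] i)) 1 ^ ![D₁, D₂] i = max (v β') 1 ^ D₁ * max (v ξ') 1 ^ D₂ :=
    fun v ↦ by rw [Fin.prod_univ_two]; rfl
  have hglob : ∏ i : Fin 2, mulHeight₁ (![β', ξ'] i) ^ ![D₁, D₂] i =
      mulHeight₁ β' ^ D₁ * mulHeight₁ ξ' ^ D₂ := by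
    rw [Fin.prod_univ_two]; rfl
  have h := one_le_absValue_mul_of_forall_absValue_le (K := F) (univ : Finset (Fin 2)) hv'0
    (x := ![β', ξ']) (e := ![D₁, D₂]) (C := C) hC1 hv₀ (fun v _ ↦ ?_) (fun v hv ↦ ?_)
  rotate_left
  · rw [hloc, ← mul_assoc]
    refine (absValue_sum_intCast_mul_pow_mul_pow_le v s a e₁ e₂ β' ξ' hD).trans ?_
    gcongr
    exact le_max_right _ _
  · rw [hloc]
    exact absValue_sum_intCast_mul_pow_mul_pow_le_of_isNonarchimedean
      (AdmissibleAbsValues.isNonarchimedean v hv) s a e₁ e₂ β' ξ' hD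
  rw [hglob, hv₀v] at h
  -- logarithms
  have hnorm : 0 < ‖∑ l ∈ s, (a l : ℂ) * β ^ e₁ l * ξ ^ e₂ l‖ := norm_pos_iff.mpr hv
  have hC0 : 0 < C := lt_of_lt_of_le one_pos hC1
  have hHβ : 0 < mulHeight₁ β' := mulHeight₁_pos _
  have hHξ : 0 < mulHeight₁ ξ' := mulHeight₁_pos _
  have hlog := Real.log_nonneg h
  rw [Real.log_mul hnorm.ne' (by positivity), Real.log_mul (by positivity) (by positivity),
    Real.log_mul (by positivity) (by positivity), Real.log_pow, Real.log_pow, Real.log_pow,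
    Nat.cast_sub (totalWeight_pos F), totalWeight_eq_finrank, Nat.cast_one] at hlog
  have eβ : Real.log (mulHeight₁ β') = Module.finrank ℚ F * weilHeight₁ F (fun _ : Unit => β) := by
    have hfin : (0 : ℝ) < Module.finrank ℚ F := by exact_mod_cast Module.finrank_pos
    rw [← logHeight₁_eq_log_mulHeight₁, weilHeight₁_single_eq F hβ, show (⟨β, hβ⟩ : F) = β' from rfl]
    field_simp
  have eξ : Real.log (mulHeight₁ ξ') = Module.finrank ℚ F * weilHeight₁ F (fun _ : Unit => ξ) := by
    have hfin : (0 : ℝ) < Module.finrank ℚ F := by exact_mod_cast Module.finrank_pos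
    rw [← logHeight₁_eq_log_mulHeight₁, weilHeight₁_single_eq F hξ, show (⟨ξ, hξ⟩ : F) = ξ' from rfl]
    field_simp
  rw [eβ, eξ] at hlog
  linarith

end SharpLiouville

end Summit.Schanuel.Schanuel.Theorems.RootDecomp1KNW96Core

end
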